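import Literature.NumberTheory.Sieve.SmoothArcClassUniformity
import HarnessLib

/-!
# Class uniformity: pointwise vanishing, free factors, closed form without CRT units, conjugate factors

Topic `Literature/NumberTheory/Sieve`; a PROVED algebraic tool file continuing `SmoothArcClassUniformity`
(generic finite exponential-sum algebra behind [MontgomeryVaughanActa1975, §5–6] and [Harper2016, §2.2, §5]).
Notation: `classWeightedSum W m r k h = Σ_{t mod L, t ≡ r (m)} e(ht/k) W((t, L))`, `L = lcm(k, m)`,
`c_n(h)` = `ramanujanSum n h`, `q` an odd prime.

* **Pointwise vanishing** (`classWeightedSum_one_eq_zero_of_two_le`, `classWeightedSum_eq_zero_of_sq_dvd`,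
  `classWeightedSum_eq_zero_of_sq_dvd_of_coprime`): for `q² ∣ k`, `(s, q) = 1` and `q ∤ h` already
  `classWeightedSum W (2q) s k h = 0` for EVERY weight `W` — in the CRT factorisation
  `classWeightedSum_mul_of_coprime_of_unit` the `q`-part `Σ_{τ < q^j, τ ≡ s (q)} e(h'τ/q^j)` (`j ≥ 2`, `q ∤ h'`)
  reproduces itself times `e(h'/q) ≠ 1` under the translation `τ ↦ τ + q^{j−1}` (`sum_range_comp_add_mod`).
* **Free factors** (`ramanujanSum_mul_natCast_of_coprime`, `classWeightedSum_one_mul_natCast_of_coprime`,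
  `sum_coprime_mul_classWeightedSum_one`): `c_n(Da) = c_n(D)` for `(n, a) = 1` (Kluyver's form
  [MontgomeryVaughan2007, Thm 4.1] only sees `(n, h)`), hence for `m = 1` the factor
  `a ↦ classWeightedSum W 1 r k (Da) = Σ_{g ∣ k} c_{k/g}(Da) W(g)` is constant on the units mod `k` and comes
  out of the `a`-sum; so the class uniformity and the vanishing for `q² ∣ k` of `SmoothArcClassUniformity`
  persist for triple products with a free third factor (`sum_coprime_classWeightedSum_mul_mul_eq`,
  `sum_coprime_classWeightedSum_mul_mul_eq_zero`).
* **Closed form without CRT units** (`sum_coprime_comp_mul_unit`, `sum_coprime_classWeightedSum_mul_eq_moebius_mul'`):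
  `b ↦ ub` permutes the units mod `k'` for a unit `u`, so the level-`k'` sum in the closed form of
  `SmoothArcClassUniformity` loses its CRT unit: for `k = q^j k'`, `q ∤ k'`,
  `Σ_{a < k, (a,k)=1} classWeightedSum W₁ (2q) r k (D₁q^v a) · classWeightedSum W₂ (2q) s k (D₂a)`
  `= μ(q^j) · Σ_{b < k', (b,k')=1} classWeightedSum W₁ 2 1 k' (D₁q^v b) · classWeightedSum W₂ 2 1 k' (D₂b)` —
  `ε_j = μ(q^j) ∈ {1, −1, 0}` times the same kind of sum at level `k'` with the odd class mod `2`.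
* **General numerators** (`sum_coprime_classWeightedSum_mul_eq_of_dvd`, `…_of_dvd_right`, `…_eq_zero_of_dvd`,
  `…_eq_moebius_mul_of_dvd`): only `c₁ ≡ 0`, `c₂ ≢ 0 (mod q)` matter for the numerators `c₁a`, `c₂a` of the
  two factors (in either order), e.g. `c = ±Dq^v`.
* **Conjugate factors** (`conj_classWeightedSum`): `conj classWeightedSum W m r k h = classWeightedSum (conj ∘ W) m r k (−h)`,
  so products containing conjugated factors (differences `d₁n₁ − d₂n₂` in the circle method) have the same shape.

## References

* H. L. Montgomery, R. C. Vaughan, Acta Arith. 27 (1975), §5–6 [MontgomeryVaughanActa1975].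
* A. J. Harper, Compositio Math. 152 (2016), §2.2, §5 [Harper2016].
* H. L. Montgomery, R. C. Vaughan, *Multiplicative Number Theory I* (2007), Thm 4.1 [MontgomeryVaughan2007].
-/

noncomputable section

open Finset Real Complex
open scoped ArithmeticFunction.Moebius FourierTransform

namespace Literature.NumberTheory.Sieve

namespace SmoothArcs

/-! ### Pointwise vanishing of the `q`-part for `j ≥ 2` -/

/-- Translation invariance of sums over a full range of residues: `Σ_{τ < Q} G((τ + c) mod Q) = Σ_{τ < Q} G(τ)`
(`c < Q`). [folklore] -/
theorem sum_range_comp_add_mod {M : Type*} [AddCommMonoid M] {Q c : ℕ} (hc : c < Q) (G : ℕ → M) :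
    ∑ τ ∈ Finset.range Q, G ((τ + c) % Q) = ∑ τ ∈ Finset.range Q, G τ := by
  haveI : NeZero Q := ⟨by omega⟩
  rw [← Fin.sum_univ_eq_sum_range (fun τ => G ((τ + c) % Q)), ← Fin.sum_univ_eq_sum_range G]
  exact Fintype.sum_equiv (Equiv.addRight (⟨c, hc⟩ : Fin Q)) _ _ fun x => by
    simp only [Equiv.coe_addRight, Fin.val_add]

/-- **The `q`-part vanishes pointwise for `j ≥ 2`.** For `q ≥ 2`, `j ≥ 2`, any class `s` and `q ∤ h`:
`classWeightedSum 1 q s (q^j) h = Σ_{τ < q^j, τ ≡ s (q)} e(hτ/q^j) = 0` — the sum reproduces itself under the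
translation `τ ↦ τ + q^{j−1}` (which preserves the class mod `q`) up to the factor `e(h/q) ≠ 1`. [folklore] -/
theorem classWeightedSum_one_eq_zero_of_two_le {q : ℕ} (hq : 1 < q) {j : ℕ} (hj : 2 ≤ j) (s : ℕ) {h : ℤ}
    (hh : ¬ (q : ℤ) ∣ h) : classWeightedSum 1 q s (q ^ j) h = 0 := by
  obtain ⟨i, rfl⟩ := Nat.exists_eq_add_of_le' hj
  have hq0 : q ≠ 0 := by omega
  have hQ0 : q ^ (i + 2) ≠ 0 := pow_ne_zero _ hq0
  have hlt : q ^ (i + 1) < q ^ (i + 2) := Nat.pow_lt_pow_right hq (by omega)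
  have hq' : (q : ℝ) ≠ 0 := by exact_mod_cast hq0
  set G : ℕ → ℂ := fun τ => if τ ≡ s [MOD q] then (𝐞 ((h * τ : ℝ) / (q ^ (i + 2) : ℕ)) : ℂ) else 0 with hG
  have hS : classWeightedSum 1 q s (q ^ (i + 2)) h = ∑ τ ∈ Finset.range (q ^ (i + 2)), G τ := by
    unfold classWeightedSum
    rw [Nat.lcm_eq_left (dvd_pow_self q (by omega)), Finset.sum_filter]
    simp only [hG, Pi.one_apply, mul_one]
  -- translation by `q^(i+1)` multiplies each term by `e(h/q)`
  have key : ∀ τ : ℕ, G ((τ + q ^ (i + 1)) % q ^ (i + 2)) = (𝐞 ((h : ℝ) / q) : ℂ) * G τ := by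
    intro τ
    have e1 : (τ + q ^ (i + 1)) % q ^ (i + 2) ≡ τ [MOD q] := by
      have h0 : q ^ (i + 1) ≡ 0 [MOD q] := Nat.modEq_zero_iff_dvd.mpr (dvd_pow_self q (by omega))
      have h1 := ((Nat.mod_modEq (τ + q ^ (i + 1)) (q ^ (i + 2))).of_dvd
        (dvd_pow_self q (by omega) : q ∣ q ^ (i + 2))).trans (Nat.ModEq.add_left τ h0)
      rwa [add_zero] at h1
    have e2 : (𝐞 ((h * ((τ + q ^ (i + 1)) % q ^ (i + 2) : ℕ) : ℝ) / (q ^ (i + 2) : ℕ)) : ℂ) =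
        (𝐞 ((h : ℝ) / q) : ℂ) * (𝐞 ((h * τ : ℝ) / (q ^ (i + 2) : ℕ)) : ℂ) := by
      rw [← fourierChar_mul_div_of_mod_eq (k := q ^ (i + 2)) (n := τ + q ^ (i + 1))
        (t := (τ + q ^ (i + 1)) % q ^ (i + 2)) hQ0 dvd_rfl rfl h]
      refine (fourierChar_mul_eq_of_add_eq ?_).symm
      push_cast
      field_simp
      ring
    simp only [hG]
    by_cases hτ : τ ≡ s [MOD q]
    · rw [if_pos (e1.trans hτ), if_pos hτ, e2]
    · rw [if_neg fun h' => hτ (e1.symm.trans h'), if_neg hτ, mul_zero]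
  have hne : (𝐞 ((h : ℝ) / q) : ℂ) ≠ 1 := fun h1 => hh ((RamanujanSum.fourierChar_div_eq_one_iff hq0 h).mp h1)
  have hfix : ∑ τ ∈ Finset.range (q ^ (i + 2)), G τ =
      (𝐞 ((h : ℝ) / q) : ℂ) * ∑ τ ∈ Finset.range (q ^ (i + 2)), G τ := by
    conv_lhs => rw [← sum_range_comp_add_mod hlt G]
    rw [Finset.mul_sum]
    exact Finset.sum_congr rfl fun τ _ => key τ
  have h0 : (1 - (𝐞 ((h : ℝ) / q) : ℂ)) * ∑ τ ∈ Finset.range (q ^ (i + 2)), G τ = 0 := by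
    rw [sub_mul, one_mul, ← hfix, sub_self]
  rw [hS]
  exact (mul_eq_zero.mp h0).resolve_left (sub_ne_zero.mpr hne.symm)

/-- **Pointwise vanishing for `q² ∣ k`.** For an odd prime `q` with `q² ∣ k`, a class `s` prime to `q` (of any parity)
and `q ∤ h`: `classWeightedSum W (2q) s k h = 0` for EVERY weight `W` (in the CRT factorisation
`classWeightedSum_mul_of_coprime_of_unit` the `q`-part is the vanishing sum of `classWeightedSum_one_eq_zero_of_two_le`
at `hu₁`, `q ∤ u₁`). [folklore] -/
theorem classWeightedSum_eq_zero_of_sq_dvd {q : ℕ} (hq : q.Prime) (hq2 : q ≠ 2) {k : ℕ} (hqk : q ^ 2 ∣ k)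
    {s : ℕ} (hs : s.Coprime q) {h : ℤ} (hh : ¬ (q : ℤ) ∣ h) (W : ℕ → ℂ) :
    classWeightedSum W (2 * q) s k h = 0 := by
  rcases eq_or_ne k 0 with rfl | hk
  · simp [classWeightedSum]
  obtain ⟨j, k', hqk', rfl⟩ := Nat.exists_eq_pow_mul_and_not_dvd hk q hq.one_lt.ne'
  have hk' : k' ≠ 0 := fun h0 => hk (by rw [h0, mul_zero])
  have hcop : q.Coprime k' := (Nat.Prime.coprime_iff_not_dvd hq).mpr hqk'
  have hj : 2 ≤ j :=
    (Nat.pow_dvd_pow_iff_le_right hq.one_lt).mp ((Nat.Coprime.pow_left 2 hcop).dvd_of_dvd_mul_right hqk)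
  obtain ⟨u₁, u₂, hu₁, hu₂⟩ := exists_crt_units (Nat.Coprime.pow_left j hcop)
  rw [mul_comm 2 q, classWeightedSum_mul_of_coprime_of_unit W (pow_ne_zero j hq.ne_zero) hk' hq.ne_zero two_ne_zero
      (coprime_pow_mul_self_mul_two hq hq2 hqk' j) (coprime_lcm_pow_of_modEq j hs) hu₁ hu₂,
    classWeightedSum_one_eq_zero_of_two_le hq.one_lt hj s (not_dvd_mul_crt_unit hq (by omega) hu₁ hh), zero_mul]

/-- … hence for `q² ∣ k`, `q ∤ D` and every unit `a (mod k)`: `classWeightedSum W (2q) s k (Da) = 0`. [folklore] -/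
theorem classWeightedSum_eq_zero_of_sq_dvd_of_coprime {q : ℕ} (hq : q.Prime) (hq2 : q ≠ 2) {k : ℕ}
    (hqk : q ^ 2 ∣ k) {s : ℕ} (hs : s.Coprime q) {D : ℤ} (hD : ¬ (q : ℤ) ∣ D) {a : ℕ} (ha : Nat.Coprime k a)
    (W : ℕ → ℂ) : classWeightedSum W (2 * q) s k (D * a) = 0 := by
  refine classWeightedSum_eq_zero_of_sq_dvd hq hq2 hqk hs (fun hdvd => ?_) W
  rcases (Nat.prime_iff_prime_int.mp hq).dvd_mul.mp hdvd with h1 | h1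
  · exact hD h1
  · exact hq.ne_one (Nat.eq_one_of_dvd_coprimes ha (dvd_trans (dvd_pow_self q two_ne_zero) hqk)
      (Int.natCast_dvd_natCast.mp h1))

/-! ### Free factors -/

/-- `c_n(ha) = c_n(h)` for `(n, a) = 1` (Kluyver's form `c_n(h) = Σ_{d ∣ (n, h)} d μ(n/d)` only sees `(n, h)`).
[cite: MontgomeryVaughan2007, Thm 4.1] -/
theorem ramanujanSum_mul_natCast_of_coprime {n a : ℕ} (hna : n.Coprime a) (h : ℤ) :
    ramanujanSum n (h * a) = ramanujanSum n h := by
  rw [ramanujanSum_eq_ramanujanDivisorSum, ramanujanSum_eq_ramanujanDivisorSum, ramanujanDivisorSum_apply,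
    ramanujanDivisorSum_apply]
  congr 1
  refine Finset.sum_congr rfl fun x hx => ?_
  have hx2 : x.2 ∣ n := Dvd.intro_left x.1 (Nat.mem_divisorsAntidiagonal.mp hx).1
  simp only [Int.natAbs_mul, Int.natAbs_natCast, (hna.coprime_dvd_left hx2).dvd_mul_right]

/-- **Free factors are constant on the units.** For `m = 1` and `(k, a) = 1`:
`classWeightedSum W 1 r k (Da) = classWeightedSum W 1 r k D` (`= Σ_{g ∣ k} c_{k/g}(D) W(g)`). [folklore] -/
theorem classWeightedSum_one_mul_natCast_of_coprime (W : ℕ → ℂ) (r : ℕ) {k a : ℕ} (hka : k.Coprime a) (D : ℤ) :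
    classWeightedSum W 1 r k (D * a) = classWeightedSum W 1 r k D := by
  rcases eq_or_ne k 0 with rfl | hk
  · simp [classWeightedSum]
  rw [classWeightedSum_eq_sum_divisors, classWeightedSum_eq_sum_divisors]
  refine Finset.sum_congr rfl fun g hg => ?_
  rw [Nat.lcm_one_right] at hg
  rw [classGcdSum_one hk, classGcdSum_one hk]
  split_ifs with hgk
  · rw [ramanujanSum_mul_natCast_of_coprime (hka.coprime_dvd_left (Nat.div_dvd_of_dvd hgk))]
  · rfl

/-- A free factor comes out of the `a`-sum over units:
`Σ_{a < k, (a,k)=1} F(a) · classWeightedSum W 1 r k (Da) = (Σ_{a < k, (a,k)=1} F(a)) · classWeightedSum W 1 r k D`. [folklore] -/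
theorem sum_coprime_mul_classWeightedSum_one (F : ℕ → ℂ) (W : ℕ → ℂ) (r k : ℕ) (D : ℤ) :
    ∑ a ∈ (Finset.range k).filter (Nat.Coprime k), F a * classWeightedSum W 1 r k (D * a) =
      (∑ a ∈ (Finset.range k).filter (Nat.Coprime k), F a) * classWeightedSum W 1 r k D := by
  rw [Finset.sum_mul]
  exact Finset.sum_congr rfl fun a ha => by
    rw [classWeightedSum_one_mul_natCast_of_coprime W r (Finset.mem_filter.mp ha).2 D]

/-- **Class uniformity with a free third factor.** Under the hypotheses of `sum_coprime_classWeightedSum_mul_eq`,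
for any `W₃`, class `r₃` (mod `1`) and `D₃ ∈ ℤ`, the `a`-sum of the triple products
`classWeightedSum W₁ (2q) r k (D₁q^v a) · classWeightedSum W₂ (2q) s k (D₂a) · classWeightedSum W₃ 1 r₃ k (D₃a)`
does not depend on the unit classes `(r, s)` either (the third factor is constant in `a`). [folklore] -/
theorem sum_coprime_classWeightedSum_mul_mul_eq {q : ℕ} (hq : q.Prime) (hq2 : q ≠ 2) (k : ℕ) {v : ℕ}
    (hv : 1 ≤ v) (D₁ : ℤ) {D₂ : ℤ} (hD₂ : ¬ (q : ℤ) ∣ D₂) (D₃ : ℤ) (W₁ W₂ W₃ : ℕ → ℂ) (r₃ : ℕ)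
    {r s r' s' : ℕ} (hr : r.Coprime (2 * q)) (hs : s.Coprime (2 * q)) (hr' : r'.Coprime (2 * q))
    (hs' : s'.Coprime (2 * q)) :
    ∑ a ∈ (Finset.range k).filter (Nat.Coprime k),
        classWeightedSum W₁ (2 * q) r k (D₁ * q ^ v * a) * classWeightedSum W₂ (2 * q) s k (D₂ * a) *
          classWeightedSum W₃ 1 r₃ k (D₃ * a) =
      ∑ a ∈ (Finset.range k).filter (Nat.Coprime k),
        classWeightedSum W₁ (2 * q) r' k (D₁ * q ^ v * a) * classWeightedSum W₂ (2 * q) s' k (D₂ * a) *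
          classWeightedSum W₃ 1 r₃ k (D₃ * a) := by
  rw [sum_coprime_mul_classWeightedSum_one, sum_coprime_mul_classWeightedSum_one,
    sum_coprime_classWeightedSum_mul_eq hq hq2 k hv D₁ hD₂ W₁ W₂ hr hs hr' hs']

/-- … and for `q² ∣ k` the `a`-sum of the triple products vanishes. [folklore] -/
theorem sum_coprime_classWeightedSum_mul_mul_eq_zero {q : ℕ} (hq : q.Prime) (hq2 : q ≠ 2) {k : ℕ}
    (hqk : q ^ 2 ∣ k) {v : ℕ} (hv : 1 ≤ v) (D₁ : ℤ) {D₂ : ℤ} (hD₂ : ¬ (q : ℤ) ∣ D₂) (D₃ : ℤ)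
    (W₁ W₂ W₃ : ℕ → ℂ) (r₃ : ℕ) {r s : ℕ} (hr : r.Coprime (2 * q)) (hs : s.Coprime (2 * q)) :
    ∑ a ∈ (Finset.range k).filter (Nat.Coprime k),
        classWeightedSum W₁ (2 * q) r k (D₁ * q ^ v * a) * classWeightedSum W₂ (2 * q) s k (D₂ * a) *
          classWeightedSum W₃ 1 r₃ k (D₃ * a) = 0 := by
  rw [sum_coprime_mul_classWeightedSum_one,
    sum_coprime_classWeightedSum_mul_eq_zero hq hq2 hqk hv D₁ hD₂ W₁ W₂ hr hs, zero_mul]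

/-! ### Reindexing the units by a unit: the closed form without CRT units -/

/-- For a unit `u (mod k)`, `b ↦ (ub) mod k` maps the units `b < k` to units `< k`. [folklore] -/
theorem toNat_mul_emod_mem_filter_coprime {k : ℕ} (hk : k ≠ 0) {u : ℤ} (hu : IsUnit (u : ZMod k)) {b : ℕ}
    (hb : b ∈ (Finset.range k).filter (Nat.Coprime k)) :
    (u * b % k).toNat ∈ (Finset.range k).filter (Nat.Coprime k) := by
  have hk0 : (0 : ℤ) < k := by exact_mod_cast Nat.pos_of_ne_zero hk
  have h0 : 0 ≤ u * b % k := Int.emod_nonneg _ hk0.ne'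
  obtain ⟨-, hbk⟩ := Finset.mem_filter.mp hb
  refine Finset.mem_filter.mpr ⟨Finset.mem_range.mpr ((Int.toNat_lt' (Nat.pos_of_ne_zero hk)).mpr
    (Int.emod_lt_of_pos _ hk0)), ?_⟩
  have hbu : IsUnit ((b : ℤ) : ZMod k) := by
    rw [Int.cast_natCast]
    exact (ZMod.isUnit_iff_coprime b k).mpr hbk.symm
  have hcast : (((u * b % k).toNat : ℕ) : ZMod k) = (u : ZMod k) * ((b : ℤ) : ZMod k) := by
    rw [← Int.cast_natCast ((u * b % k).toNat), Int.toNat_of_nonneg h0, ZMod.intCast_mod, Int.cast_mul]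
  have hunit : IsUnit (((u * b % k).toNat : ℕ) : ZMod k) := by
    rw [hcast]
    exact hu.mul hbu
  exact ((ZMod.isUnit_iff_coprime _ k).mp hunit).symm

/-- … and `(w · ((ub) mod k)) mod k = b` for `wu ≡ 1 (mod k)`, `b < k`. [folklore] -/
theorem toNat_mul_emod_toNat_mul_emod {k : ℕ} (hk : k ≠ 0) {u w : ℤ} (hwu : w * u ≡ 1 [ZMOD k]) {b : ℕ}
    (hb : b < k) : (w * ((u * b % k).toNat : ℕ) % k).toNat = b := by
  have hk0 : (0 : ℤ) < k := by exact_mod_cast Nat.pos_of_ne_zero hk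
  rw [Int.toNat_of_nonneg (Int.emod_nonneg _ hk0.ne')]
  have h1 : w * (u * b % k) ≡ b [ZMOD k] := by
    have h2 : w * (u * b % k) ≡ w * (u * b) [ZMOD k] := Int.ModEq.mul_left w (Int.mod_modEq _ _)
    have h3 : w * (u * b) ≡ 1 * b [ZMOD k] := by
      rw [← mul_assoc]
      exact hwu.mul_right _
    rw [one_mul] at h3
    exact h2.trans h3
  rw [h1, Int.emod_eq_of_lt (Int.natCast_nonneg b) (by exact_mod_cast hb), Int.toNat_natCast]

/-- **Reindexing the units by a unit.** For `uw ≡ 1 (mod k)` and `Φ` depending on its argument only mod `k`: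
`Σ_{b < k, (b,k)=1} Φ(ub) = Σ_{b < k, (b,k)=1} Φ(b)` (`b ↦ ub` permutes the units mod `k`). [folklore] -/
theorem sum_coprime_comp_mul_unit {k : ℕ} {u w : ℤ} (huw : u * w ≡ 1 [ZMOD k]) (Φ : ℤ → ℂ)
    (hΦ : ∀ x y : ℤ, x ≡ y [ZMOD k] → Φ x = Φ y) :
    ∑ b ∈ (Finset.range k).filter (Nat.Coprime k), Φ (u * b) =
      ∑ b ∈ (Finset.range k).filter (Nat.Coprime k), Φ b := by
  rcases eq_or_ne k 0 with rfl | hk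
  · simp
  have hk0 : (0 : ℤ) < k := by exact_mod_cast Nat.pos_of_ne_zero hk
  have hwu : w * u ≡ 1 [ZMOD k] := by rwa [mul_comm] at huw
  have hone : ∀ {x y : ℤ}, x * y ≡ 1 [ZMOD k] → IsUnit (x : ZMod k) := fun {x y} hxy => by
    refine IsUnit.of_mul_eq_one (y : ZMod k) ?_
    have e := (ZMod.intCast_eq_intCast_iff (x * y) 1 k).mpr hxy
    push_cast at e
    exact e
  refine Finset.sum_nbij' (fun b => (u * b % k).toNat) (fun b => (w * b % k).toNat)
    (fun b hb => toNat_mul_emod_mem_filter_coprime hk (hone huw) hb)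
    (fun b hb => toNat_mul_emod_mem_filter_coprime hk (hone hwu) hb)
    (fun b hb => toNat_mul_emod_toNat_mul_emod hk hwu (Finset.mem_range.mp (Finset.mem_filter.mp hb).1))
    (fun b hb => toNat_mul_emod_toNat_mul_emod hk huw (Finset.mem_range.mp (Finset.mem_filter.mp hb).1))
    fun b _ => hΦ _ _ ?_
  rw [Int.toNat_of_nonneg (Int.emod_nonneg _ hk0.ne')]
  exact (Int.mod_modEq _ _).symm

/-- **Class uniformity, closed form without CRT units.** For an odd prime `q`, `k = q^j k'` with `q ∤ k'`,
`k' ≥ 1`, `v ≥ 1`, any `D₁ ∈ ℤ`, `q ∤ D₂`, ARBITRARY weights `W₁, W₂` and unit classes `r, s (mod 2q)`: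
`Σ_{a < k, (a,k)=1} classWeightedSum W₁ (2q) r k (D₁q^v a) · classWeightedSum W₂ (2q) s k (D₂a)`
`= ε_j · Σ_{b < k', (b,k')=1} classWeightedSum W₁ 2 1 k' (D₁q^v b) · classWeightedSum W₂ 2 1 k' (D₂b)`,
`ε_j = μ(q^j)` (`= 1, −1, 0` for `j = 0, 1, ≥ 2`): the same kind of `a`-sum at level `k'` with the classes
mod `2q` replaced by the odd class mod `2`. [folklore] -/
theorem sum_coprime_classWeightedSum_mul_eq_moebius_mul' {q : ℕ} (hq : q.Prime) (hq2 : q ≠ 2) {j k' : ℕ}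
    (hk' : k' ≠ 0) (hqk' : ¬ q ∣ k') {v : ℕ} (hv : 1 ≤ v) (D₁ : ℤ) {D₂ : ℤ} (hD₂ : ¬ (q : ℤ) ∣ D₂)
    (W₁ W₂ : ℕ → ℂ) {r s : ℕ} (hr : r.Coprime (2 * q)) (hs : s.Coprime (2 * q)) :
    ∑ a ∈ (Finset.range (q ^ j * k')).filter (Nat.Coprime (q ^ j * k')),
        classWeightedSum W₁ (2 * q) r (q ^ j * k') (D₁ * q ^ v * a) *
          classWeightedSum W₂ (2 * q) s (q ^ j * k') (D₂ * a) =
      (μ (q ^ j) : ℂ) * ∑ b ∈ (Finset.range k').filter (Nat.Coprime k'),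
        classWeightedSum W₁ 2 1 k' (D₁ * q ^ v * b) * classWeightedSum W₂ 2 1 k' (D₂ * b) := by
  obtain ⟨u₁, u₂, hu₁, hu₂⟩ :=
    exists_crt_units (Nat.Coprime.pow_left j ((Nat.Prime.coprime_iff_not_dvd hq).mpr hqk'))
  rw [sum_coprime_classWeightedSum_mul_eq_moebius_mul hq hq2 hk' hqk' hu₁ hu₂ hv D₁ hD₂ W₁ W₂ hr hs]
  congr 1
  have key := sum_coprime_comp_mul_unit hu₂
    (fun x => classWeightedSum W₁ 2 1 k' (D₁ * q ^ v * x) * classWeightedSum W₂ 2 1 k' (D₂ * x))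
    (fun x y hxy => by
      rw [classWeightedSum_congr_intModEq W₁ 2 1 (hxy.mul_left (D₁ * q ^ v)),
        classWeightedSum_congr_intModEq W₂ 2 1 (hxy.mul_left D₂)])
  simp only [← mul_assoc] at key
  exact key

/-! ### General numerators -/

/-- **Class uniformity, general numerators.** For an odd prime `q`, any `k`, `c₁ ≡ 0`, `c₂ ≢ 0 (mod q)`,
ARBITRARY weights `W₁, W₂` and unit classes `r, s, r', s' (mod 2q)`:
`Σ_{a < k, (a,k)=1} classWeightedSum W₁ (2q) r k (c₁a) · classWeightedSum W₂ (2q) s k (c₂a)` does not depend on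
`(r, s)` (`sum_coprime_classWeightedSum_mul_eq` is the case `c₁ = D₁q^v`, `v ≥ 1`, `c₂ = D₂`). [folklore] -/
theorem sum_coprime_classWeightedSum_mul_eq_of_dvd {q : ℕ} (hq : q.Prime) (hq2 : q ≠ 2) (k : ℕ) {c₁ c₂ : ℤ}
    (hc₁ : (q : ℤ) ∣ c₁) (hc₂ : ¬ (q : ℤ) ∣ c₂) (W₁ W₂ : ℕ → ℂ) {r s r' s' : ℕ} (hr : r.Coprime (2 * q))
    (hs : s.Coprime (2 * q)) (hr' : r'.Coprime (2 * q)) (hs' : s'.Coprime (2 * q)) :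
    ∑ a ∈ (Finset.range k).filter (Nat.Coprime k),
        classWeightedSum W₁ (2 * q) r k (c₁ * a) * classWeightedSum W₂ (2 * q) s k (c₂ * a) =
      ∑ a ∈ (Finset.range k).filter (Nat.Coprime k),
        classWeightedSum W₁ (2 * q) r' k (c₁ * a) * classWeightedSum W₂ (2 * q) s' k (c₂ * a) := by
  obtain ⟨d, rfl⟩ := hc₁
  have e : ∀ a : ℕ, ((q : ℤ) * d * a : ℤ) = d * (q : ℤ) ^ 1 * a := fun a => by ring
  simp only [e]
  exact sum_coprime_classWeightedSum_mul_eq hq hq2 k le_rfl d hc₂ W₁ W₂ hr hs hr' hs'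

/-- … the same with the roles of the two factors exchanged (`q ∤ c₁`, `q ∣ c₂`). [folklore] -/
theorem sum_coprime_classWeightedSum_mul_eq_of_dvd_right {q : ℕ} (hq : q.Prime) (hq2 : q ≠ 2) (k : ℕ)
    {c₁ c₂ : ℤ} (hc₁ : ¬ (q : ℤ) ∣ c₁) (hc₂ : (q : ℤ) ∣ c₂) (W₁ W₂ : ℕ → ℂ) {r s r' s' : ℕ}
    (hr : r.Coprime (2 * q)) (hs : s.Coprime (2 * q)) (hr' : r'.Coprime (2 * q)) (hs' : s'.Coprime (2 * q)) :
    ∑ a ∈ (Finset.range k).filter (Nat.Coprime k),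
        classWeightedSum W₁ (2 * q) r k (c₁ * a) * classWeightedSum W₂ (2 * q) s k (c₂ * a) =
      ∑ a ∈ (Finset.range k).filter (Nat.Coprime k),
        classWeightedSum W₁ (2 * q) r' k (c₁ * a) * classWeightedSum W₂ (2 * q) s' k (c₂ * a) := by
  have e : ∀ ρ σ : ℕ, ∑ a ∈ (Finset.range k).filter (Nat.Coprime k),
      classWeightedSum W₁ (2 * q) ρ k (c₁ * a) * classWeightedSum W₂ (2 * q) σ k (c₂ * a) =
      ∑ a ∈ (Finset.range k).filter (Nat.Coprime k),
        classWeightedSum W₂ (2 * q) σ k (c₂ * a) * classWeightedSum W₁ (2 * q) ρ k (c₁ * a) :=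
    fun ρ σ => Finset.sum_congr rfl fun a _ => mul_comm _ _
  rw [e, e, sum_coprime_classWeightedSum_mul_eq_of_dvd hq hq2 k hc₂ hc₁ W₂ W₁ hs hr hs' hr']

/-- **Vanishing for `q² ∣ k`, general numerators** (`q ∣ c₁`, `q ∤ c₂`, unit classes `r, s (mod 2q)`). [folklore] -/
theorem sum_coprime_classWeightedSum_mul_eq_zero_of_dvd {q : ℕ} (hq : q.Prime) (hq2 : q ≠ 2) {k : ℕ}
    (hqk : q ^ 2 ∣ k) {c₁ c₂ : ℤ} (hc₁ : (q : ℤ) ∣ c₁) (hc₂ : ¬ (q : ℤ) ∣ c₂) (W₁ W₂ : ℕ → ℂ) {r s : ℕ}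
    (hr : r.Coprime (2 * q)) (hs : s.Coprime (2 * q)) :
    ∑ a ∈ (Finset.range k).filter (Nat.Coprime k),
        classWeightedSum W₁ (2 * q) r k (c₁ * a) * classWeightedSum W₂ (2 * q) s k (c₂ * a) = 0 := by
  obtain ⟨d, rfl⟩ := hc₁
  have e : ∀ a : ℕ, ((q : ℤ) * d * a : ℤ) = d * (q : ℤ) ^ 1 * a := fun a => by ring
  simp only [e]
  exact sum_coprime_classWeightedSum_mul_eq_zero hq hq2 hqk le_rfl d hc₂ W₁ W₂ hr hs

/-- **Closed form, general numerators, no CRT units**: for `k = q^j k'`, `q ∤ k'`, `q ∣ c₁`, `q ∤ c₂`,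
`Σ_{a < k, (a,k)=1} classWeightedSum W₁ (2q) r k (c₁a) · classWeightedSum W₂ (2q) s k (c₂a)`
`= μ(q^j) · Σ_{b < k', (b,k')=1} classWeightedSum W₁ 2 1 k' (c₁b) · classWeightedSum W₂ 2 1 k' (c₂b)`. [folklore] -/
theorem sum_coprime_classWeightedSum_mul_eq_moebius_mul_of_dvd {q : ℕ} (hq : q.Prime) (hq2 : q ≠ 2)
    {j k' : ℕ} (hk' : k' ≠ 0) (hqk' : ¬ q ∣ k') {c₁ c₂ : ℤ} (hc₁ : (q : ℤ) ∣ c₁) (hc₂ : ¬ (q : ℤ) ∣ c₂)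
    (W₁ W₂ : ℕ → ℂ) {r s : ℕ} (hr : r.Coprime (2 * q)) (hs : s.Coprime (2 * q)) :
    ∑ a ∈ (Finset.range (q ^ j * k')).filter (Nat.Coprime (q ^ j * k')),
        classWeightedSum W₁ (2 * q) r (q ^ j * k') (c₁ * a) * classWeightedSum W₂ (2 * q) s (q ^ j * k') (c₂ * a) =
      (μ (q ^ j) : ℂ) * ∑ b ∈ (Finset.range k').filter (Nat.Coprime k'),
        classWeightedSum W₁ 2 1 k' (c₁ * b) * classWeightedSum W₂ 2 1 k' (c₂ * b) := by
  obtain ⟨d, rfl⟩ := hc₁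
  have e : ∀ a : ℕ, ((q : ℤ) * d * a : ℤ) = d * (q : ℤ) ^ 1 * a := fun a => by ring
  simp only [e]
  exact sum_coprime_classWeightedSum_mul_eq_moebius_mul' hq hq2 hk' hqk' le_rfl d hc₂ W₁ W₂ hr hs

/-! ### Conjugate factors -/

/-- Complex conjugation: `conj (classWeightedSum W m r k h) = classWeightedSum (conj ∘ W) m r k (−h)`
(`conj e(x) = e(−x)`), so conjugated factors are again weighted class sums of the same shape. [folklore] -/
theorem conj_classWeightedSum (W : ℕ → ℂ) (m r k : ℕ) (h : ℤ) :
    starRingEnd ℂ (classWeightedSum W m r k h) = classWeightedSum (fun g => starRingEnd ℂ (W g)) m r k (-h) := by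
  unfold classWeightedSum
  rw [map_sum]
  refine Finset.sum_congr rfl fun t _ => ?_
  have e : (((-h : ℤ) : ℝ) * t / k : ℝ) = -((h * t : ℝ) / k) := by push_cast; ring
  rw [map_mul, e, AddChar.map_neg_eq_inv, Circle.coe_inv_eq_conj]

end SmoothArcs

end Literature.NumberTheory.Sieve

end
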